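import Summits.CriticalPhenomena.Ising3DConformalLimit.Theorems.EnergyNotSigmaSquaredMoebiusLimitExistsPinnedTwoPoint
import Literature.Probability.LatticeModels.CriticalWickDichotomy
import Literature.Probability.LatticeModels.GaussianPairingBound
import Summits.CriticalPhenomena.Ising3DConformalLimit.Theorems.GapForcesFarMerging.Negative.IsingCertificate
import Mathlib.Topology.Sequences
import HarnessLib

/-!
# Local bounds for the pinned zoom of the critical `ℤ³` correlators
(line `only-interaction-breaks-moebius` of the crux `MoebiusLimitExists`, item stmt-CriticalPhenomena-1344;
registered sub-goal `pinnedZoomLocallyBounded` of the stub `stub_compactness`)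

With the PINNED renormalisation `ρ_pin(δ) = ⟨σ₀σ_{⌊1/δ⌋e₀}⟩_{β_c}^{-1/2}` (`rhoPin`), the pinned zoom
`F_n(k, x) = ρ_pin(u k)ⁿ ⟨σ_{[x₁/u k]} ⋯ σ_{[xₙ/u k]}⟩_{β_c}` along a mesh sequence `u k → 0⁺` is
EVENTUALLY UNIFORMLY BOUNDED on every compact set `K` of non-coincident configurations, granted the
two-point law `⟨σ₀σ_y⟩_{β_c}‖y‖₂^{2Δ} → c > 0` (`y → ∞`; item stmt-0634, passed as data). This is
hypothesis (i) of the abstract compactness schema (`…CompactnessSchema.lean`) for `stub_compactness`.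

Proof.
* Odd `n`: the critical odd correlators vanish (`criticalCorr_eq_zero_of_odd`), bound `0`.
* `n = 2m`: by Griffiths' first inequality (the tree's `criticalCorr_nonneg'`) and NEWMAN'S GAUSSIAN
  INEQUALITY for the critical state in infinite volume (`criticalCorr_le_pairingSum`: box limit, free
  boundary condition, of the tree's finite-volume theorem `aizenman_nPoint_le_pairingSum_finite_holds`),
  `0 ≤ ⟨∏σ_{zᵢ}⟩_{β_c} ≤ 𝒢_m[⟨σσ⟩_{β_c}](z)`. Multiplying by `ρ_pin^{2m} = (ρ_pin²)^m ≥ 0` and reading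
  the pairing functional at the level of INDICES (`PairIsing.pairingSum_eq_pow_mul`), `F_{2m}(k, x)` is
  dominated by the pairing functional of the kernel `(i, j) ↦ ρ_pin² ⟨σ_{[xᵢ/δ]}σ_{[xⱼ/δ]}⟩_{β_c}`
  (`i ≠ j`), each entry of which is the pinned PAIR zoom at the pair `(xᵢ, xⱼ)`, ranging over the compact
  set `{(xᵢ, xⱼ) : x ∈ K}` of non-coincident pairs.
* The pair zoom is eventually uniformly bounded on compact sets of non-coincident pairs
  (`exists_eventually_rescaledCorrelator_two_le`): otherwise there are `k_j → ∞` and pairs `p_j` with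
  values `> j`; a subsequence of the `p_j` converges to a non-coincident pair `p₀`, and along it the
  pair zoom CONVERGES (to `‖p₀ 1 − p₀ 0‖^{-2Δ}`) by the two-point law — the continuous-convergence form
  (`tendsto_rescaledCorrelator_two_of_tendsto`) of the landed `stub_pinnedTwoPoint`: the pair zoom is
  the ratio `⟨σ₀σ_{z}⟩/⟨σ₀σ_{⌊1/δ⌋e₀}⟩` (`rescaledCorrelator_rhoPin_two`) and both sites escape to
  infinity with `δ‖z‖₂ → ‖p₀ 1 − p₀ 0‖`, `δ⌊1/δ⌋ → 1`.
* A pairing functional with entries in `[0, B]` is at most `(2m)! Bᵐ` (`pairingSum_le_factorial_mul_pow`).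

References: C. M. Newman, Z. Wahrsch. 33 (1975) (Gaussian inequality); M. Aizenman, H. Duminil-Copin,
Ann. Math. 194 (2021), §6.3 first display (lower inequality); S. Friedli, Y. Velenik (CUP 2017),
Thm. 3.20 (GKS); H. Duminil-Copin, ICM 2022, §8.1 (two-point law). No definitions are introduced.
-/

noncomputable section

open Filter Topology Set Function
open Literature.Probability.LatticeModels

namespace Summit.CriticalPhenomena.Ising3DConformalLimit.MoebiusLimitExistsOnlyInteraction

/-! ### Lattice input: Newman's Gaussian inequality for the critical state -/

/-- **Newman's Gaussian inequality for the critical state on `ℤ³`** (lower half of Aizenman's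
inequality, infinite volume): `⟨∏_{i<2m} σ_{yᵢ}⟩_{β_c} ≤ 𝒢_m[⟨σσ⟩_{β_c}](y)` for every `m` and every
`y : Fin (2m) → ℤ³` (coincidences allowed). For `m ≥ 2` it is the box limit (free boundary condition,
`criticalCorr_wellDefined_holds`) of the finite-volume theorem
`aizenman_nPoint_le_pairingSum_finite_holds`; `m = 1` is `𝒢₁[S₂](a,b) = S₂(a,b)`, `m = 0` is `⟨1⟩ ≤ 1`.
[cite: AizenmanDuminilCopinAnnals2021, arXiv:1912.07973 §6.3, first display, lower inequality (p. 26)] -/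
theorem criticalCorr_le_pairingSum (m : ℕ) (y : Fin (2 * m) → Site 3) :
    criticalCorr 3 (2 * m) y ≤ pairingSum (fun a b => criticalCorr 3 2 ![a, b]) m y := by
  classical
  rcases Nat.lt_or_ge m 2 with hm | hm
  · interval_cases m
    · rw [pairingSum_zero]
      exact (le_abs_self _).trans (abs_criticalCorr_le_one le_rfl _ _)
    · rw [pairingSum_one _ fun a b => criticalCorr_two_pair_comm a b]
      apply le_of_eq
      show plusExpect 3 (criticalBeta 3) 0 (spinMonomial y) =
        plusExpect 3 (criticalBeta 3) 0 (spinMonomial ![y 0, y 1])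
      congr 1
  · have hmem : (BoundaryCondition.free : BoundaryCondition (Site 3)) ∈
        ({.free, .plus, .minus} : Set (BoundaryCondition (Site 3))) := by simp
    have hN : Tendsto (fun L : ℕ => nPoint (isingMeasure (zdGraph 3) (box 3 L) (criticalBeta 3) 0 .free)
        spinAt y) atTop (𝓝 (criticalCorr 3 (2 * m) y)) :=
      criticalCorr_wellDefined_holds (d := 3) le_rfl (2 * m) y .free hmem
    have hT : ∀ a b : Site 3, Tendsto (fun L : ℕ => twoPoint (isingMeasure (zdGraph 3) (box 3 L)
        (criticalBeta 3) 0 .free) spinAt a b) atTop (𝓝 (criticalCorr 3 2 ![a, b])) := by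
      intro a b
      refine Tendsto.congr (fun L => ?_)
        (criticalCorr_wellDefined_holds (d := 3) le_rfl 2 ![a, b] .free hmem)
      simp only [twoPoint, isingExpect, spinMonomial, Fin.prod_univ_two, Matrix.cons_val_zero,
        Matrix.cons_val_one]
    refine le_of_tendsto_of_tendsto hN (tendsto_pairingSum hT m y) ?_
    filter_upwards [eventually_forall_mem_box y] with L hL
    exact aizenman_nPoint_le_pairingSum_finite_holds (box 3 L) (criticalBeta 3) (criticalBeta_nonneg 3)
      m hm y hL

/-- A pairing functional with entries in `[0, B]` is at most `(2m)! · Bᵐ`: each of the `(2m)!`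
orderings contributes a product `≤ Bᵐ`, and `(2ᵐ m!)⁻¹ ≤ 1`. [folklore] -/
theorem pairingSum_le_factorial_mul_pow {α : Type*} {S : α → α → ℝ} {B : ℝ}
    (h0 : ∀ a b, 0 ≤ S a b) (hle : ∀ a b, S a b ≤ B) (m : ℕ) (x : Fin (2 * m) → α) :
    pairingSum S m x ≤ (2 * m).factorial * B ^ m := by
  unfold pairingSum
  have hsum0 : 0 ≤ ∑ τ : Equiv.Perm (Fin (2 * m)),
      ∏ j : Fin m, S (x (τ (pairIdx m (j, 0)))) (x (τ (pairIdx m (j, 1)))) :=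
    Finset.sum_nonneg fun τ _ => Finset.prod_nonneg fun j _ => h0 _ _
  have hsum : ∑ τ : Equiv.Perm (Fin (2 * m)),
      ∏ j : Fin m, S (x (τ (pairIdx m (j, 0)))) (x (τ (pairIdx m (j, 1)))) ≤
        (2 * m).factorial * B ^ m := by
    calc ∑ τ : Equiv.Perm (Fin (2 * m)),
          ∏ j : Fin m, S (x (τ (pairIdx m (j, 0)))) (x (τ (pairIdx m (j, 1))))
        ≤ ∑ _τ : Equiv.Perm (Fin (2 * m)), B ^ m := by
          refine Finset.sum_le_sum fun τ _ => ?_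
          calc ∏ j : Fin m, S (x (τ (pairIdx m (j, 0)))) (x (τ (pairIdx m (j, 1))))
              ≤ ∏ _j : Fin m, B := Finset.prod_le_prod (fun j _ => h0 _ _) fun j _ => hle _ _
            _ = B ^ m := by rw [Finset.prod_const, Finset.card_univ, Fintype.card_fin]
      _ = (2 * m).factorial * B ^ m := by
          rw [Finset.sum_const, Finset.card_univ, Fintype.card_perm, Fintype.card_fin, nsmul_eq_mul]
  have hc : ((2 : ℝ) ^ m * m.factorial)⁻¹ ≤ 1 := by
    apply inv_le_one_of_one_le₀
    have h1 : (1 : ℝ) ≤ 2 ^ m := one_le_pow₀ (by norm_num)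
    have h2 : (1 : ℝ) ≤ m.factorial := by exact_mod_cast m.factorial_pos
    nlinarith
  calc ((2 : ℝ) ^ m * m.factorial)⁻¹ * ∑ τ : Equiv.Perm (Fin (2 * m)),
        ∏ j : Fin m, S (x (τ (pairIdx m (j, 0)))) (x (τ (pairIdx m (j, 1))))
      ≤ 1 * ∑ τ : Equiv.Perm (Fin (2 * m)),
        ∏ j : Fin m, S (x (τ (pairIdx m (j, 0)))) (x (τ (pairIdx m (j, 1)))) :=
        mul_le_mul_of_nonneg_right hc hsum0
    _ ≤ (2 * m).factorial * B ^ m := by rw [one_mul]; exact hsum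

/-! ### The pinned pair zoom along convergent sequences of pairs -/

/-- Along a mesh sequence `u k → 0⁺` and a convergent sequence of pairs `x k → x₀`,
`u k · ([x k 1/u k] − [x k 0/u k])ᵢ → (x₀ 1 − x₀ 0)ᵢ` coordinatewise
(`|δ([q/δ]ᵢ − [p/δ]ᵢ) − (qᵢ − pᵢ)| ≤ 2δ`). [folklore] -/
theorem tendsto_mul_latticeApprox_sub_apply_of_tendsto {u : ℕ → ℝ}
    (hu : Tendsto u atTop (𝓝[>] (0 : ℝ))) {x : ℕ → Fin 2 → EuclideanSpace ℝ (Fin 3)}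
    {x₀ : Fin 2 → EuclideanSpace ℝ (Fin 3)} (hx : Tendsto x atTop (𝓝 x₀)) (i : Fin 3) :
    Tendsto (fun k => u k * ((latticeApprox (u k) (x k 1) - latticeApprox (u k) (x k 0)) i : ℝ)) atTop
      (𝓝 ((x₀ 1 - x₀ 0) i)) := by
  have hu0 : Tendsto u atTop (𝓝 0) := (tendsto_nhdsWithin_iff.1 hu).1
  have hupos : ∀ᶠ k in atTop, 0 < u k := (tendsto_nhdsWithin_iff.1 hu).2
  have hA : Tendsto (fun k => u k * ((latticeApprox (u k) (x k 1) - latticeApprox (u k) (x k 0)) i : ℝ)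
      - (x k 1 - x k 0) i) atTop (𝓝 0) := by
    rw [tendsto_zero_iff_norm_tendsto_zero]
    have h2 : Tendsto (fun k => 2 * u k) atTop (𝓝 0) := by
      simpa using hu0.const_mul (2 : ℝ)
    refine squeeze_zero' (Eventually.of_forall fun k => norm_nonneg _) ?_ h2
    filter_upwards [hupos] with k hk
    rw [Real.norm_eq_abs, Pi.sub_apply, Int.cast_sub, PiLp.sub_apply]
    exact abs_mul_sub_latticeApprox_sub_le hk (x k 1) (x k 0) i
  have hB : Tendsto (fun k => (x k 1 - x k 0) i) atTop (𝓝 ((x₀ 1 - x₀ 0) i)) := by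
    have hc : Continuous fun z : Fin 2 → EuclideanSpace ℝ (Fin 3) => (z 1 - z 0) i := by fun_prop
    exact (hc.tendsto x₀).comp hx
  have h := hA.add hB
  rw [zero_add] at h
  exact h.congr fun k => sub_add_cancel _ _

/-- The two-point function at the pinning site along a mesh sequence `u k → 0⁺` under the
two-point law: `⟨σ₀σ_{⌊1/u k⌋e₀}⟩_{β_c} (u k)^{-2Δ} → c` (`⌊1/δ⌋e₀ = [e₀/δ] − [0/δ]`, `δ⌊1/δ⌋ → 1`).
[folklore] -/
theorem tendsto_criticalTwoPoint_pin_mul_rpow {Δ c : ℝ}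
    (hG : Tendsto (fun y : Site 3 => criticalTwoPoint 3 y * Real.sqrt (∑ i, ((y i : ℝ)) ^ 2) ^ (2 * Δ))
      cofinite (𝓝 c))
    {u : ℕ → ℝ} (hu : Tendsto u atTop (𝓝[>] (0 : ℝ))) :
    Tendsto (fun k => criticalTwoPoint 3 (Pi.single 0 (⌊1 / u k⌋ : ℤ) : Site 3) * (u k) ^ (-(2 * Δ)))
      atTop (𝓝 c) := by
  -- adapted from the landed `stub_pinnedTwoPoint` (denominator step)
  have he₀ : (EuclideanSpace.single 0 (1 : ℝ) : EuclideanSpace ℝ (Fin 3)) - 0 ≠ 0 := by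
    rw [sub_zero, Ne, PiLp.single_eq_zero_iff]
    exact one_ne_zero
  have h := tendsto_criticalTwoPoint_mul_rpow (Δ := Δ) hG hu he₀
    (fun i => tendsto_mul_latticeApprox_sub_apply hu 0 (EuclideanSpace.single 0 (1 : ℝ)) i)
  have h1 : ‖(EuclideanSpace.single 0 (1 : ℝ) : EuclideanSpace ℝ (Fin 3)) - 0‖ = 1 := by
    rw [sub_zero, PiLp.norm_single, norm_one]
  rw [h1, Real.one_rpow, mul_one] at h
  refine h.congr' (Eventually.of_forall fun k => ?_)
  simp only [piSingle_floor_eq_latticeApprox_sub]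

/-- **Continuous convergence of the pinned pair zoom.** Under the two-point law
`⟨σ₀σ_y⟩_{β_c}‖y‖₂^{2Δ} → c > 0`, along a mesh sequence `u k → 0⁺` and pairs `x k → x₀` with
`x₀ 0 ≠ x₀ 1`, `ρ_pin(u k)² ⟨σ_{[x k 0/u k]} σ_{[x k 1/u k]}⟩_{β_c} → ‖x₀ 1 − x₀ 0‖^{-2Δ}`: the pair zoom
is the ratio `⟨σ₀σ_{z_k}⟩/⟨σ₀σ_{⌊1/u k⌋e₀}⟩` with `u k · z_k → x₀ 1 − x₀ 0 ≠ 0`.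
[cite: DuminilCopinICM2022, §8.1 eq. (8.1)–(8.2)] -/
theorem tendsto_rescaledCorrelator_two_of_tendsto {Δ c : ℝ} (hc : 0 < c)
    (hG : Tendsto (fun y : Site 3 => criticalTwoPoint 3 y * Real.sqrt (∑ i, ((y i : ℝ)) ^ 2) ^ (2 * Δ))
      cofinite (𝓝 c))
    {u : ℕ → ℝ} (hu : Tendsto u atTop (𝓝[>] (0 : ℝ))) {x : ℕ → Fin 2 → EuclideanSpace ℝ (Fin 3)}
    {x₀ : Fin 2 → EuclideanSpace ℝ (Fin 3)} (hx : Tendsto x atTop (𝓝 x₀)) (h01 : x₀ 0 ≠ x₀ 1) :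
    Tendsto (fun k => rescaledCorrelator (criticalCorr 3) rhoPin 2 (u k) (x k)) atTop
      (𝓝 (‖x₀ 1 - x₀ 0‖ ^ (-(2 * Δ)))) := by
  have hupos : ∀ᶠ k in atTop, 0 < u k := (tendsto_nhdsWithin_iff.1 hu).2
  -- numerator: the two-point function at `z_k = [x k 1/u k] − [x k 0/u k]`
  have hz : Tendsto (fun k => criticalTwoPoint 3
      (latticeApprox (u k) (x k 1) - latticeApprox (u k) (x k 0)) * (u k) ^ (-(2 * Δ))) atTop
      (𝓝 (c * ‖x₀ 1 - x₀ 0‖ ^ (-(2 * Δ)))) :=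
    tendsto_criticalTwoPoint_mul_rpow hG hu (sub_ne_zero.2 h01.symm)
      (fun i => tendsto_mul_latticeApprox_sub_apply_of_tendsto hu hx i)
  -- denominator: the two-point function at the pinning site
  have hw := tendsto_criticalTwoPoint_pin_mul_rpow (Δ := Δ) hG hu
  have hq := hz.div hw hc.ne'
  rw [mul_div_assoc, mul_div_left_comm, div_self hc.ne', mul_one] at hq
  refine hq.congr' ?_
  filter_upwards [hupos] with k hk
  rw [Pi.div_apply, mul_div_mul_right _ _ (Real.rpow_pos_of_pos hk _).ne',
    rescaledCorrelator_rhoPin_two]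

/-- **Eventual uniform bound for the pinned pair zoom on compacts.** Under the two-point law, on a
compact set `P` of non-coincident pairs the pinned rescaled pair correlators at mesh `u k` are bounded,
uniformly on `P`, for all large `k`: otherwise there are `k_j → ∞` and `p_j ∈ P` with values `> j`,
a subsequence of the `p_j` converges in `P`, and along it the values converge
(`tendsto_rescaledCorrelator_two_of_tendsto`), a contradiction. [folklore] -/
theorem exists_eventually_rescaledCorrelator_two_le {Δ c : ℝ} (hc : 0 < c)
    (hG : Tendsto (fun y : Site 3 => criticalTwoPoint 3 y * Real.sqrt (∑ i, ((y i : ℝ)) ^ 2) ^ (2 * Δ))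
      cofinite (𝓝 c))
    {u : ℕ → ℝ} (hu : Tendsto u atTop (𝓝[>] (0 : ℝ)))
    {P : Set (Fin 2 → EuclideanSpace ℝ (Fin 3))} (hP : IsCompact P) (hPs : P ⊆ NonCoincident 3 2) :
    ∃ B : ℝ, ∀ᶠ k in atTop, ∀ p ∈ P, rescaledCorrelator (criticalCorr 3) rhoPin 2 (u k) p ≤ B := by
  by_contra hcon
  have hfreq : ∀ j : ℕ, ∃ᶠ k in atTop, ∃ p ∈ P,
      (j : ℝ) < rescaledCorrelator (criticalCorr 3) rhoPin 2 (u k) p := by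
    intro j
    have hj : ¬ ∀ᶠ k in atTop, ∀ p ∈ P,
        rescaledCorrelator (criticalCorr 3) rhoPin 2 (u k) p ≤ (j : ℝ) := fun h => hcon ⟨j, h⟩
    rw [not_eventually] at hj
    refine hj.mono fun k hk => ?_
    by_contra hk'
    refine hk fun p hp => ?_
    by_contra hlt
    exact hk' ⟨p, hp, lt_of_not_ge hlt⟩
  obtain ⟨φ, hφ, hφP⟩ := extraction_forall_of_frequently hfreq
  choose p hpP hpF using hφP
  obtain ⟨p₀, hp₀, ψ, hψ, hlim⟩ := hP.tendsto_subseq hpP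
  have h01 : p₀ 0 ≠ p₀ 1 := ((mem_nonCoincident p₀).1 (hPs hp₀)).ne (by decide)
  have hu' : Tendsto (u ∘ φ ∘ ψ) atTop (𝓝[>] (0 : ℝ)) := hu.comp (hφ.comp hψ).tendsto_atTop
  have hconv := tendsto_rescaledCorrelator_two_of_tendsto (Δ := Δ) hc hG hu' hlim h01
  have hev₁ := hconv.eventually (eventually_lt_nhds (lt_add_one (‖p₀ 1 - p₀ 0‖ ^ (-(2 * Δ)))))
  have hev₂ : ∀ᶠ j : ℕ in atTop, ‖p₀ 1 - p₀ 0‖ ^ (-(2 * Δ)) + 1 ≤ (j : ℝ) :=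
    tendsto_natCast_atTop_atTop.eventually_ge_atTop _
  obtain ⟨j, hj₁, hj₂⟩ := (hev₁.and hev₂).exists
  have hj₃ : ((ψ j : ℕ) : ℝ) < rescaledCorrelator (criticalCorr 3) rhoPin 2 (u (φ (ψ j))) (p (ψ j)) :=
    hpF (ψ j)
  have hj₄ : (j : ℝ) ≤ (ψ j : ℝ) := Nat.cast_le.2 hψ.le_apply
  simp only [Function.comp_apply] at hj₁
  linarith

/-! ### The stub -/

/-- **Registered sub-goal `pinnedZoomLocallyBounded` of `stub_compactness` (line
`only-interaction-breaks-moebius`) — local bounds for the pinned zoom.** Under the two-point law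
`⟨σ₀σ_y⟩_{β_c}‖y‖₂^{2Δ} → c > 0` (item stmt-0634, passed as data), along every mesh sequence
`u k → 0⁺`, on every compact set `K` of non-coincident configurations the pinned rescaled critical
`n`-point correlators `ρ_pin(u k)ⁿ ⟨∏ σ_{[xᵢ/u k]}⟩_{β_c}` are bounded, uniformly in `x ∈ K`, for all
large `k`. Odd `n`: identically `0`. Even `n = 2m`: `0 ≤ ⟨∏σ⟩ ≤ 𝒢_m[⟨σσ⟩]` (Griffiths I, the
tree's `criticalCorr_nonneg'`; Newman's Gaussian inequality, `criticalCorr_le_pairingSum`), the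
rescaled pairing functional is the pairing functional of the pinned pair zooms
`ρ_pin²⟨σ_{[xᵢ/δ]}σ_{[xⱼ/δ]}⟩` (`i ≠ j`), each eventually bounded by a common `B₂` on `K`
(`exists_eventually_rescaledCorrelator_two_le` on the compact pair-sets `{(xᵢ,xⱼ) : x ∈ K}`), whence the
bound `(2m)! B₂ᵐ`. [cite: AizenmanDuminilCopinAnnals2021, arXiv:1912.07973 §6.3, first display, lower inequality (p. 26)] -/
theorem pinnedZoomLocallyBounded :
    ∀ (Δ c : ℝ), 0 < c →
      Tendsto (fun y : Site 3 => criticalTwoPoint 3 y * Real.sqrt (∑ i, ((y i : ℝ)) ^ 2) ^ (2 * Δ))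
        cofinite (𝓝 c) →
      ∀ u : ℕ → ℝ, Tendsto u atTop (𝓝[>] (0 : ℝ)) →
        ∀ n (K : Set (Fin n → EuclideanSpace ℝ (Fin 3))), IsCompact K → K ⊆ NonCoincident 3 n →
          ∃ B : ℝ, ∀ᶠ k in atTop, ∀ x ∈ K, |rescaledCorrelator (criticalCorr 3) rhoPin n (u k) x| ≤ B := by
  intro Δ c hc hG u hu n K hK hKs
  rcases Nat.even_or_odd n with hn | hn
  swap
  · -- odd orders vanish identically
    refine ⟨0, Eventually.of_forall fun k x _ => ?_⟩
    rw [rescaledCorrelator_apply, criticalCorr_eq_zero_of_odd (d := 3) le_rfl hn, mul_zero, abs_zero]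
  obtain ⟨m, hm⟩ := hn
  rw [← two_mul] at hm
  subst hm
  -- the rescaled pair kernel at the level of indices (diagonal zeroed), as an opaque function
  obtain ⟨T, hT⟩ : ∃ T : ℕ → (Fin (2 * m) → EuclideanSpace ℝ (Fin 3)) → Fin (2 * m) → Fin (2 * m) → ℝ,
      ∀ k x i j, T k x i j = if i = j then 0 else
        rhoPin (u k) ^ 2 * criticalCorr 3 2 ![latticeApprox (u k) (x i), latticeApprox (u k) (x j)] :=
    ⟨fun k x i j => if i = j then 0 else
        rhoPin (u k) ^ 2 * criticalCorr 3 2 ![latticeApprox (u k) (x i), latticeApprox (u k) (x j)],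
      fun _ _ _ _ => rfl⟩
  have hTeq : ∀ k x i j, i ≠ j →
      T k x i j = rescaledCorrelator (criticalCorr 3) rhoPin 2 (u k) ![x i, x j] := by
    intro k x i j hij
    rw [hT, if_neg hij, rescaledCorrelator_apply, latticeApprox_comp_two]
    rfl
  have hT0 : ∀ k x i j, 0 ≤ T k x i j := by
    intro k x i j
    rw [hT]
    split_ifs
    · exact le_rfl
    · exact mul_nonneg (sq_nonneg _) (criticalCorr_two_nonneg _ _)
  -- eventual bounds for each entry, from the pair zoom on the compact pair-sets `{(xᵢ, xⱼ) : x ∈ K}`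
  have hpair : ∀ ij : Fin (2 * m) × Fin (2 * m), ∃ B : ℝ, ∀ᶠ k in atTop, ∀ x ∈ K,
      T k x ij.1 ij.2 ≤ B := by
    rintro ⟨i, j⟩
    show ∃ B : ℝ, ∀ᶠ k in atTop, ∀ x ∈ K, T k x i j ≤ B
    by_cases hij : i = j
    · refine ⟨0, Eventually.of_forall fun k x _ => ?_⟩
      rw [hT, if_pos hij]
    · have hcont : Continuous fun x : Fin (2 * m) → EuclideanSpace ℝ (Fin 3) =>
          (![x i, x j] : Fin 2 → EuclideanSpace ℝ (Fin 3)) :=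
        (continuous_apply i).matrixVecCons ((continuous_apply j).matrixVecCons continuous_const)
      have hPc : IsCompact ((fun x : Fin (2 * m) → EuclideanSpace ℝ (Fin 3) =>
          (![x i, x j] : Fin 2 → EuclideanSpace ℝ (Fin 3))) '' K) := hK.image hcont
      have hPs : (fun x : Fin (2 * m) → EuclideanSpace ℝ (Fin 3) =>
          (![x i, x j] : Fin 2 → EuclideanSpace ℝ (Fin 3))) '' K ⊆ NonCoincident 3 2 := by
        rintro _ ⟨x, hx, rfl⟩
        exact pair_mem_nonCoincident fun h => hij ((mem_nonCoincident x).1 (hKs hx) h)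
      obtain ⟨B, hB⟩ := exists_eventually_rescaledCorrelator_two_le (Δ := Δ) hc hG hu hPc hPs
      refine ⟨B, hB.mono fun k hk x hx => ?_⟩
      rw [hTeq k x i j hij]
      exact hk _ (Set.mem_image_of_mem _ hx)
  choose B hB using hpair
  obtain ⟨B₂, hBle⟩ : ∃ B₂ : ℝ, ∀ ij, B ij ≤ B₂ :=
    ⟨∑ ij, max (B ij) 0, fun ij => (le_max_left _ _).trans (Finset.single_le_sum
      (f := fun ij => max (B ij) 0) (fun ij _ => le_max_right _ _) (Finset.mem_univ ij))⟩
  have hall : ∀ᶠ k in atTop, ∀ ij : Fin (2 * m) × Fin (2 * m), ∀ x ∈ K, T k x ij.1 ij.2 ≤ B ij :=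
    eventually_all.2 hB
  refine ⟨(2 * m).factorial * B₂ ^ m, ?_⟩
  filter_upwards [hall] with k hk x hx
  have hTB : ∀ i j, T k x i j ≤ B₂ := fun i j => (hk (i, j) x hx).trans (hBle (i, j))
  -- index-level rescaling identity
  have hP : pairingSum (T k x) m id = (rhoPin (u k) ^ 2) ^ m *
      pairingSum (fun a b => criticalCorr 3 2 ![a, b]) m (fun i => latticeApprox (u k) (x i)) :=
    PairIsing.pairingSum_eq_pow_mul (fun a b => criticalCorr 3 2 ![a, b]) (T k x) (rhoPin (u k) ^ 2) m
      (fun i => latticeApprox (u k) (x i)) id fun i j hij => by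
        simp only [hT, id_eq, if_neg hij]
  have hF : rescaledCorrelator (criticalCorr 3) rhoPin (2 * m) (u k) x =
      (rhoPin (u k) ^ 2) ^ m * criticalCorr 3 (2 * m) (fun i => latticeApprox (u k) (x i)) := by
    rw [rescaledCorrelator_apply, pow_mul]
  have hρ : 0 ≤ (rhoPin (u k) ^ 2) ^ m := pow_nonneg (sq_nonneg _) m
  have hnn : 0 ≤ criticalCorr 3 (2 * m) (fun i => latticeApprox (u k) (x i)) :=
    Theorems.GapForcesFarMerging.Negative.criticalCorr_nonneg' _
  rw [hF, abs_of_nonneg (mul_nonneg hρ hnn)]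
  calc (rhoPin (u k) ^ 2) ^ m * criticalCorr 3 (2 * m) (fun i => latticeApprox (u k) (x i))
      ≤ (rhoPin (u k) ^ 2) ^ m *
          pairingSum (fun a b => criticalCorr 3 2 ![a, b]) m (fun i => latticeApprox (u k) (x i)) :=
        mul_le_mul_of_nonneg_left (criticalCorr_le_pairingSum m _) hρ
    _ = pairingSum (T k x) m id := hP.symm
    _ ≤ (2 * m).factorial * B₂ ^ m := pairingSum_le_factorial_mul_pow (hT0 k x) hTB m id

end Summit.CriticalPhenomena.Ising3DConformalLimit.MoebiusLimitExistsOnlyInteraction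

end
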